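import Summits.QuantumFields.YangMills.Theorems.UnitScaleTiltProp7NestedMeanPoincare
import Literature.MathematicalPhysics.QuantumFieldTheory.Balaban1983to89.B5Eq118OneStroke
import HarnessLib

/-!
# Route `UnitScaleTilt`, crux K1 child «MinimiserStabilityRegPr» (stmt-QuantumFields-19200), skeleton v10, stub `stub_existenceMinimalOrbit` (EX), route (α) —
# **R2a′-alg: THE NESTED COVARIANT BLOCK MEAN IS A COMB-TYPE MEAN UP TO THE TOWER CLOSENESS** (the algebra of R2a′ in ★w5-20520 g7's (P2-core) plan v2): for ANY averaging
# sequence `ns` in MEAN form (`ns 0 = l`, `ns_{j+1}(y) = |Idx|⁻¹·Σ_i Ad_{T_{j,y,i}} ns_j(x_{y,i})`, `x_{y,i} = blockSite y i.1` — the recursion of ✓`QTwS_gaugeDir_of_avgSeq` after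
# `meanCLM_apply`), any reference unitaries `C_{j,z,x}` (`C_{0,x,x} = 1`) and DISPLAYED per-level closeness `‖T_{j,y,i}·C_{j,x_{y,i},x} − C_{j+1,y,x}‖ ≤ η_j` on the sub-blocks:
# **`‖ns_k(y) − L^{−dk}·Σ_{x∈B^k(y)} Ad_{C_{k,y,x}} l(x)‖ ≤ (2Σ_{j<k}η_j)·L^{−dk}·Σ_{x∈B^k(y)}‖l(x)‖`** — so `ns_k l = 0` makes the `C_k`-means of `l` `δ`-small relative to the block mass,
# `δ = 2Σ_{j<k}η_j`: the hypothesis `hcomb` of ✓`Prop7NestedMeanPoincare.normSq_toL2S_le_two_mul_of_combMean_small` at `C_{k,y,·} :=` the comb holonomies (R2a′-tower supplies `η_j`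
# from `RegPr`; not here).  Pure finite-sum algebra: nesting ✓`sum_iterBlock_succ`, ✓`B10StarCount.sum_block`, the `Idx` mean over stair orderings, unitary conjugation isometric.

Cell `ym3-torus`, width seat `ym3-torus-px20` (gen 0).  THEOREMS ONLY (0 `def`, 0 `sorry`).  `--supports stmt-QuantumFields-19200 --as helper`, count-neutral.  YM₃ on T³ is a ladder
rung (R3), not the Clay problem; nothing here claims the stub, the crux, d = 4 or the mass gap.

WHAT IS PROVED (sorry-free, no definition; ns `…Theorems.Prop7NestedMeanPoincare`): `sum_idx_fst`
(`Σ_{i:Idx} g(i.1) = |Perm|²•Σ_r g r`); ★★★`norm_ns_sub_refMean_le` (the displayed-closeness induction, any `P`, `M_N(ℂ)`, levels `k ≤ m + K`).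
HONEST SCOPE: algebra only; the closeness data `η_j` and the identification of `C_k` with the comb holonomies on `fibreSite` are the caller's; nothing of print asserted.

References: T. Bałaban, CMP 98 (1985) 17–51 [Balaban1985Averaging] ((11) p.19, (82) p.30, (97) p.32); CMP 95 (1984) 17–40 [Balaban1984PropagatorsI] ((1.16)–(1.18) p.20);
CMP 99 (1985) 389–434 [Balaban1985BackgroundPropagators] ((3.19) p.393, Thm 3.11 p.416).
-/

set_option autoImplicit false

noncomputable section

open scoped BigOperators Matrix.Norms.L2Operator

namespace Summit.QuantumFields.YangMills.Theorems.Prop7NestedMeanPoincare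

open Literature.MathematicalPhysics.QuantumFieldTheory.Balaban1983to89
open Finset
open BlockAveraging (Idx)
open B7Prop1Explicit (U1 mem_U1)
open B7Eq78Linearization (conjR conjR_apply conjR_sub conjR_smul_real)
open B8Ineq132 (norm_conjR conjR_conjR one_conjR conjR_sum)
open B5Eq118OneStroke (iterBlockOf iterBlock mem_iterBlock iterBlock_zero sum_iterBlock_succ)
open B10StarCount (sum_block)
open Summit.QuantumFields.YangMills.Theorems.Prop7CovariantCoercivity (norm_conjR_sub_conjR_le)

variable {N : ℕ} [NeZero N]

/-! ## §1 Letters -/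

section Idx

variable {P : Params}

/-- a sum over the stair index set `Idx P = offsets × orderings × orderings` of a function of the OFFSET only is `|Perm|²` copies of the offset sum. [folklore] -/
theorem sum_idx_fst {M : Type*} [AddCommMonoid M] (g : (Fin P.d → Fin P.L) → M) :
    ∑ i : Idx P, g i.1 = (Fintype.card (Equiv.Perm (Fin P.d)) * Fintype.card (Equiv.Perm (Fin P.d))) • ∑ r : Fin P.d → Fin P.L, g r := by
  rw [Fintype.sum_prod_type]
  simp only [Finset.sum_const, Finset.card_univ, Fintype.card_prod]
  rw [← Finset.smul_sum]

end Idx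

/-! ## §2 The induction down the tower -/

section Induction

variable {P : Params}

set_option maxHeartbeats 400000 in
/-- ★★★ **THE NESTED COVARIANT MEAN AGAINST A REFERENCE COMB-TYPE MEAN, LEVEL BY LEVEL.**  Let `ns` be an averaging sequence in mean form — `ns 0 = l`,
`ns_{j+1}(y) = |Idx|⁻¹·Σ_{i} Ad_{T_{j,y,i}} ns_j(blockSite y i.1)` with unitary (`U1`) transports `T` — and `C_{j,z,x}` unitary references with `C_{0,x,x} = 1` and the per-level
closeness `‖T_{j,y,i}·C_{j,blockSite y i.1,x} − C_{j+1,y,x}‖ ≤ η_j` for `x ∈ B^j(blockSite y i.1)`.  Then for every `k ≤ m + K` and `y ∈ T^{(k)}`: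
`‖ns_k(y) − (L^d)^{−k}·Σ_{x∈B^k(y)} Ad_{C_{k,y,x}} l(x)‖ ≤ (2Σ_{j<k}η_j)·(L^d)^{−k}·Σ_{x∈B^k(y)}‖l(x)‖`.  Induction: the nesting `B^{j+1}(y) = ⊔_r B^j(blockSite y r)` (✓`sum_iterBlock_succ`,
✓`sum_block`), the `Idx` mean over orderings (`sum_idx_fst`), `‖Ad_T(ns_j − A_j)‖ = ‖ns_j − A_j‖`, and `‖Ad_{TC_j} − Ad_{C_{j+1}}‖ ≤ 2η_j` termwise.
[cite: Balaban1985Averaging, (97) p.32, (82) p.30; Balaban1984PropagatorsI, (1.16)–(1.18) p.20; Balaban1985BackgroundPropagators, (3.19) p.393] -/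
theorem norm_ns_sub_refMean_le
    (T : (j : ℕ) → Site P (j + 1) → Idx P → (Matrix (Fin N) (Fin N) ℂ)ˣ) (hT : ∀ j y i, T j y i ∈ U1 (Matrix (Fin N) (Fin N) ℂ))
    (ns : (j : ℕ) → Site P j → Matrix (Fin N) (Fin N) ℂ) (l : Site P 0 → Matrix (Fin N) (Fin N) ℂ) (h0 : ∀ x, ns 0 x = l x)
    (hstep : ∀ (j : ℕ) (y : Site P (j + 1)), ns (j + 1) y = ((Fintype.card (Idx P) : ℝ)⁻¹) • ∑ i : Idx P, conjR (T j y i) (ns j (Site.blockSite y i.1)))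
    (C : (j : ℕ) → Site P j → Site P 0 → (Matrix (Fin N) (Fin N) ℂ)ˣ) (hC : ∀ j z x, C j z x ∈ U1 (Matrix (Fin N) (Fin N) ℂ)) (hC0 : ∀ x, C 0 x x = 1)
    (η : ℕ → ℝ)
    (hclose : ∀ (j : ℕ) (y : Site P (j + 1)) (i : Idx P), ∀ x ∈ iterBlock j (Site.blockSite y i.1),
      ‖((T j y i : (Matrix (Fin N) (Fin N) ℂ)ˣ) : Matrix (Fin N) (Fin N) ℂ) * (C j (Site.blockSite y i.1) x : Matrix (Fin N) (Fin N) ℂ) - (C (j + 1) y x : Matrix (Fin N) (Fin N) ℂ)‖ ≤ η j) :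
    ∀ (k : ℕ), k ≤ P.m + P.K → ∀ y : Site P k,
      ‖ns k y - ((((P.L : ℝ) ^ P.d) ^ k)⁻¹) • ∑ x ∈ iterBlock k y, conjR (C k y x) (l x)‖
        ≤ (2 * ∑ j ∈ range k, η j) * (((((P.L : ℝ) ^ P.d) ^ k)⁻¹) * ∑ x ∈ iterBlock k y, ‖l x‖) := by
  intro k
  induction k with
  | zero =>
    intro _ y
    rw [iterBlock_zero, Finset.sum_singleton, Finset.sum_singleton, hC0, one_conjR, h0, pow_zero, inv_one, one_smul, sub_self, norm_zero,
      Finset.sum_range_zero, mul_zero, zero_mul]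
  | succ j ih =>
    intro hj y
    have hj' : j ≤ P.m + P.K := by omega
    have hj1 : j + 1 ≤ P.m + P.K := hj
    have hL : (0 : ℝ) < (P.L : ℝ) ^ P.d := by have := P.L_pos; positivity
    set p : ℕ := Fintype.card (Equiv.Perm (Fin P.d)) * Fintype.card (Equiv.Perm (Fin P.d)) with hp
    have hp0 : (0 : ℝ) < (p : ℝ) := by
      have : 0 < Fintype.card (Equiv.Perm (Fin P.d)) := Fintype.card_pos
      rw [hp]; positivity
    have hcI : (Fintype.card (Idx P) : ℝ) = (P.L : ℝ) ^ P.d * p := by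
      have hc : Fintype.card (Idx P) = P.L ^ P.d * p := by
        rw [hp, Fintype.card_prod, Fintype.card_prod, Fintype.card_fun, Fintype.card_fin, Fintype.card_fin]
      rw [hc]; push_cast; ring
    -- abbreviations at level `j`
    set cj : ℝ := ((((P.L : ℝ) ^ P.d) ^ j)⁻¹) with hcj
    have hcj0 : 0 ≤ cj := by rw [hcj]; positivity
    set A : Site P j → Matrix (Fin N) (Fin N) ℂ := fun z => cj • ∑ x ∈ iterBlock j z, conjR (C j z x) (l x) with hA
    set M : Site P j → ℝ := fun z => cj * ∑ x ∈ iterBlock j z, ‖l x‖ with hM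
    set δ : ℝ := 2 * ∑ t ∈ range j, η t with hδ
    have hIH : ∀ z : Site P j, ‖ns j z - A z‖ ≤ δ * M z := fun z => ih hj' z
    -- the scalar bookkeeping `(L^d)^{-(j+1)} = |Idx|⁻¹·|Perm|²·(L^d)^{-j}`
    have hscal : ((((P.L : ℝ) ^ P.d) ^ (j + 1))⁻¹) = (Fintype.card (Idx P) : ℝ)⁻¹ * (p : ℝ) * cj := by
      rw [hcI, hcj, pow_succ, mul_inv, mul_inv]
      field_simp
    -- nesting of the blocks
    have eL : ∀ (F : Site P 0 → Matrix (Fin N) (Fin N) ℂ), ∑ x ∈ iterBlock (j + 1) y, F x = ∑ r : Fin P.d → Fin P.L, ∑ x ∈ iterBlock j (Site.blockSite y r), F x :=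
      fun F => by rw [sum_iterBlock_succ, sum_block hj1 y]
    have eL' : ∑ x ∈ iterBlock (j + 1) y, ‖l x‖ = ∑ r : Fin P.d → Fin P.L, ∑ x ∈ iterBlock j (Site.blockSite y r), ‖l x‖ := by
      rw [sum_iterBlock_succ, sum_block hj1 y]
    have hsplitA : ((((P.L : ℝ) ^ P.d) ^ (j + 1))⁻¹) • ∑ x ∈ iterBlock (j + 1) y, conjR (C (j + 1) y x) (l x)
        = ((Fintype.card (Idx P) : ℝ)⁻¹) • ∑ i : Idx P, cj • ∑ x ∈ iterBlock j (Site.blockSite y i.1), conjR (C (j + 1) y x) (l x) := by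
      rw [eL, hscal, ← smul_smul, ← smul_smul, Finset.smul_sum,
        sum_idx_fst (fun r => cj • ∑ x ∈ iterBlock j (Site.blockSite y r), conjR (C (j + 1) y x) (l x)), ← hp, Nat.cast_smul_eq_nsmul]
    have hsplitM : ((((P.L : ℝ) ^ P.d) ^ (j + 1))⁻¹) * ∑ x ∈ iterBlock (j + 1) y, ‖l x‖
        = ((Fintype.card (Idx P) : ℝ)⁻¹) * ∑ i : Idx P, M (Site.blockSite y i.1) := by
      rw [sum_idx_fst (fun r => M (Site.blockSite y r)), ← hp, nsmul_eq_mul, eL', hscal]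
      simp only [hM]
      rw [← Finset.mul_sum]
      ring
    -- termwise bound
    have hterm : ∀ i : Idx P, ‖conjR (T j y i) (ns j (Site.blockSite y i.1)) - cj • ∑ x ∈ iterBlock j (Site.blockSite y i.1), conjR (C (j + 1) y x) (l x)‖
        ≤ (δ + 2 * η j) * M (Site.blockSite y i.1) := by
      intro i
      set z := Site.blockSite y i.1 with hz
      have h1 : ‖conjR (T j y i) (ns j z) - conjR (T j y i) (A z)‖ ≤ δ * M z := by
        rw [← conjR_sub, norm_conjR (hT j y i)]; exact hIH z
      have h2 : conjR (T j y i) (A z) = cj • ∑ x ∈ iterBlock j z, conjR (T j y i * C j z x) (l x) := by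
        simp only [hA]
        rw [conjR_smul_real, conjR_sum]
        congr 1
        exact Finset.sum_congr rfl fun x _ => conjR_conjR _ _ _
      have h3 : ‖cj • ∑ x ∈ iterBlock j z, conjR (T j y i * C j z x) (l x) - cj • ∑ x ∈ iterBlock j z, conjR (C (j + 1) y x) (l x)‖ ≤ 2 * η j * M z := by
        rw [← smul_sub, ← Finset.sum_sub_distrib, norm_smul, Real.norm_of_nonneg hcj0]
        have hsum : ‖∑ x ∈ iterBlock j z, (conjR (T j y i * C j z x) (l x) - conjR (C (j + 1) y x) (l x))‖ ≤ ∑ x ∈ iterBlock j z, 2 * η j * ‖l x‖ := by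
          refine (norm_sum_le _ _).trans (Finset.sum_le_sum fun x hx => ?_)
          have hU : T j y i * C j z x ∈ U1 (Matrix (Fin N) (Fin N) ℂ) := (U1 _).mul_mem (hT j y i) (hC j z x)
          refine (norm_conjR_sub_conjR_le (hC (j + 1) y x) hU (l x)).trans ?_
          have hTC : ‖((T j y i * C j z x : (Matrix (Fin N) (Fin N) ℂ)ˣ) : Matrix (Fin N) (Fin N) ℂ) - (C (j + 1) y x : Matrix (Fin N) (Fin N) ℂ)‖ ≤ η j := by
            rw [Units.val_mul]; exact hclose j y i x (by rw [← hz]; exact hx)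
          exact mul_le_mul_of_nonneg_right (mul_le_mul_of_nonneg_left hTC (by norm_num)) (norm_nonneg _)
        calc cj * ‖∑ x ∈ iterBlock j z, (conjR (T j y i * C j z x) (l x) - conjR (C (j + 1) y x) (l x))‖
            ≤ cj * ∑ x ∈ iterBlock j z, 2 * η j * ‖l x‖ := mul_le_mul_of_nonneg_left hsum hcj0
          _ = 2 * η j * M z := by simp only [hM]; rw [← Finset.mul_sum]; ring
      calc ‖conjR (T j y i) (ns j z) - cj • ∑ x ∈ iterBlock j z, conjR (C (j + 1) y x) (l x)‖
          ≤ ‖conjR (T j y i) (ns j z) - conjR (T j y i) (A z)‖ + ‖conjR (T j y i) (A z) - cj • ∑ x ∈ iterBlock j z, conjR (C (j + 1) y x) (l x)‖ :=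
            norm_sub_le_norm_sub_add_norm_sub _ _ _
        _ ≤ δ * M z + 2 * η j * M z := by
            have h3' : ‖conjR (T j y i) (A z) - cj • ∑ x ∈ iterBlock j z, conjR (C (j + 1) y x) (l x)‖ ≤ 2 * η j * M z := by
              rw [h2]; exact h3
            exact add_le_add h1 h3'
        _ = (δ + 2 * η j) * M z := by ring
    -- assemble
    have hδ' : 2 * ∑ t ∈ range (j + 1), η t = δ + 2 * η j := by rw [Finset.sum_range_succ, hδ]; ring
    have hcI0 : 0 ≤ (Fintype.card (Idx P) : ℝ)⁻¹ := by positivity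
    have hfin : ‖((Fintype.card (Idx P) : ℝ)⁻¹) • ∑ i : Idx P,
        (conjR (T j y i) (ns j (Site.blockSite y i.1)) - cj • ∑ x ∈ iterBlock j (Site.blockSite y i.1), conjR (C (j + 1) y x) (l x))‖
          ≤ (Fintype.card (Idx P) : ℝ)⁻¹ * ∑ i : Idx P, (δ + 2 * η j) * M (Site.blockSite y i.1) := by
      rw [norm_smul, norm_inv, Real.norm_natCast]
      exact mul_le_mul_of_nonneg_left ((norm_sum_le _ _).trans (Finset.sum_le_sum fun i _ => hterm i)) hcI0
    rw [hstep j y, hsplitA, hsplitM, hδ', ← smul_sub, ← Finset.sum_sub_distrib]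
    refine hfin.trans (le_of_eq ?_)
    rw [← Finset.mul_sum]
    ring

end Induction

end Summit.QuantumFields.YangMills.Theorems.Prop7NestedMeanPoincare

end
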